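import Literature.MathematicalPhysics.QuantumFieldTheory.ConformalBootstrap3D.PointKernelK34L505Data
import Literature.MathematicalPhysics.QuantumFieldTheory.ConformalBootstrap3D.PointKernelK34L505Segs
import Literature.MathematicalPhysics.QuantumFieldTheory.ConformalBootstrap3D.PointKernelParts

/-!
# K34L505 certificate, kernel part file P53: one-cell head segments 117, 118, 119 in level ranges

The head cells whose kernel evaluation exceeds one `decide` are one-cell segments of `hsegsK34L505`; each is
checked by `PCert.hPartSideOK` (side conditions) and `PCert.hPartOK` per level range `[n_lo, n_lo + count)`
against an integer claim, the claims summing to `≥ 0` (`PointKernel.partsOK`); soundness is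
`PCert.hParts_sound` (`PointKernelParts`).  The part files are mutually independent (each imports only
the data file); the ranges of one cell may span several of them, and the per-cell conclusions
`hparts_i` / `hcell_i` of those cells are assembled in `PointKernelK34L505.lean`.
Estimated kernel time 209 s.
-/

set_option maxRecDepth 100000
set_option maxHeartbeats 0

namespace Literature.MathematicalPhysics.QuantumFieldTheory.ConformalBootstrap3D.PointKernelK34L505

open Literature.MathematicalPhysics.QuantumFieldTheory.ConformalBootstrap3D.PointKernel

/-- levels `[0, 32)` of segment 117: partial lower sum `≥` claim. [folklore] -/
theorem part_117_0 : certK34L505.hPartOK (PCert.segAt hsegsK34L505 117) JHK34L505 0 32 (-8627637495442924764908040063661291319) = true := by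
  decide +kernel

/-- levels `[32, 41)` of segment 117: partial lower sum `≥` claim. [folklore] -/
theorem part_117_1 : certK34L505.hPartOK (PCert.segAt hsegsK34L505 117) JHK34L505 32 9 (8627637495442924764908040063661291319) = true := by
  decide +kernel

/-- one-cell segment 118 (row 6, cell `[1801/256, 901/128]`, chord, `n_F = 40`,
2 level ranges): side conditions. [folklore] -/
theorem pside_118 : certK34L505.hPartSideOK (PCert.segAt hsegsK34L505 118) JHK34L505 = true := by
  decide +kernel

/-- its level ranges `(n_lo, count, claim)`. [folklore] -/
def partsK34L505_118 : List (ℕ × ℕ × ℤ) := [(0, 32, -8017898184796872708891599124614627303), (32, 9, 8017898184796872708891599124614627303)]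

/-- the ranges tile `[0, n_F]` and the claims sum to `≥ 0`. [folklore] -/
theorem pcov_118 : PointKernel.partsOK 40 partsK34L505_118 = true := by
  decide +kernel

/-- levels `[0, 32)` of segment 118: partial lower sum `≥` claim. [folklore] -/
theorem part_118_0 : certK34L505.hPartOK (PCert.segAt hsegsK34L505 118) JHK34L505 0 32 (-8017898184796872708891599124614627303) = true := by
  decide +kernel

/-- levels `[32, 41)` of segment 118: partial lower sum `≥` claim. [folklore] -/
theorem part_118_1 : certK34L505.hPartOK (PCert.segAt hsegsK34L505 118) JHK34L505 32 9 (8017898184796872708891599124614627303) = true := by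
  decide +kernel

/-- one-cell segment 119 (row 6, cell `[901/128, 451/64]`, chord, `n_F = 48`,
3 level ranges): side conditions. [folklore] -/
theorem pside_119 : certK34L505.hPartSideOK (PCert.segAt hsegsK34L505 119) JHK34L505 = true := by
  decide +kernel

/-- its level ranges `(n_lo, count, claim)`. [folklore] -/
def partsK34L505_119 : List (ℕ × ℕ × ℤ) := [(0, 31, -11037173248942104616881523624906422388), (31, 13, 10128208013632687268971323987383014251), (44, 5, 908965235309417347910199637523408137)]

/-- the ranges tile `[0, n_F]` and the claims sum to `≥ 0`. [folklore] -/
theorem pcov_119 : PointKernel.partsOK 48 partsK34L505_119 = true := by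
  decide +kernel

end Literature.MathematicalPhysics.QuantumFieldTheory.ConformalBootstrap3D.PointKernelK34L505
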